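import Mathlib

/-!
# The ORDERED-HALF pencil fails over `ZMod 7` already for four sets

Helper file for crux `stmt-CriticalPhenomena-4575` (`NoHeavyLowerTail`, route `PercNearOneGluingNoHeavy`),
new-inequality factory seat `prim-ineq-gen-3` (gen 25).  Everything here is PROVED; no definitions.

CONJECTURE ORD (gen 25, memo `run/shared/lean/prim/prim-ineq-gen-3/CONJECTURE-ORD.md`): for distinct finite sets
`A₁, …, Aₘ` listed ADMISSIBLY (`i < j ⟹ Aᵢ ⊄ Aⱼ`) the pencil rows `C ↦ (E ↦ [E ⊆ C] + t [E ∩ C = ∅])` restricted to the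
ORDERED HALF `T = {∅} ∪ {Aᵢ \ Aⱼ : i < j}` of the difference family are linearly independent for every COMPLEX `t` with
`t² ≠ 1` (0 failures in ≈ 12 000 (family, order) pairs; the order filter of `…OrderedDifferencesOrderFilter` certifies it
family by family).  At `t = 0` this is the ordered Marica–Schönheim theorem `OrderedDifferences.card_le_card_of_sdiff_mem`
(true over every field).  For `t ≠ 0` the statement is genuinely of characteristic `0`: here is a family of FOUR sets on six
points, `A₁ = {0,1,3,4}`, `A₂ = {1,2,4,5}`, `A₃ = {3,4}`, `A₄ = {0,1,2}` (admissible in this order), whose ordered-half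
pencil is singular over `ZMod 7` at `t = 4` (`4 · 4 = 2 ≠ 1`), with kernel vector `(2, 3, 1, 1)`.  Over `ℚ` the two local
determinants of the order filter are `(t²-1)(t²-2t-1)` (co-traces at `A₁`) and `(1+t)(1-2t)` (traces at `A₄`), coprime away
from `t = -1` but with resultant `-7`: both vanish at `t = 4 ∈ ZMod 7`.  By contrast the FULL pencil (all of `𝒜 \\ 𝒜`) of every
family with at most five members is non-singular for `t² ≠ 1` over every field (exhaustive computation, kit j218540–3, gen 24),
so restricting to the ordered half enlarges the set of bad characteristics — while (conjecturally) never creating a bad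
complex `t`.
* `ordHalf_four_sets_sdiff` — the ordered half of this family is `{∅, {0,3}, {0,1}, {3,4}, {1,2,5}, {4,5}}`;
* `ordHalf_four_sets_sum_zero` — the vector `(2,3,1,1)` kills every column of the ordered half over `ZMod 7` at `t = 4`;
* `ordHalf_four_sets_not_linearIndependent` — hence the ordered-half pencil rows are dependent over `ZMod 7` at `t = 4`.
(prim-ineq-gen-3 gen 25, 2026-08-24.)
-/

namespace Summit.CriticalPhenomena.PercolationContinuityZ3.Theorems

namespace OrderedDifferences

open Finset

/-- The six ordered differences `Aᵢ \ Aⱼ` (`i < j`) of `A₁ = {0,1,3,4}`, `A₂ = {1,2,4,5}`, `A₃ = {3,4}`, `A₄ = {0,1,2}`: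
together with `∅` they form the ordered half `{∅, {0,3}, {0,1}, {3,4}, {1,2,5}, {4,5}}` (and the order is admissible:
no `Aᵢ` is contained in a later `Aⱼ`). -/
theorem ordHalf_four_sets_sdiff :
    (({0, 1, 3, 4} : Finset (Fin 6)) \ {1, 2, 4, 5} = {0, 3}) ∧ (({0, 1, 3, 4} : Finset (Fin 6)) \ {3, 4} = {0, 1}) ∧
    (({0, 1, 3, 4} : Finset (Fin 6)) \ {0, 1, 2} = {3, 4}) ∧ (({1, 2, 4, 5} : Finset (Fin 6)) \ {3, 4} = {1, 2, 5}) ∧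
    (({1, 2, 4, 5} : Finset (Fin 6)) \ {0, 1, 2} = {4, 5}) ∧ (({3, 4} : Finset (Fin 6)) \ {0, 1, 2} = {3, 4}) ∧
    ¬ ({0, 1, 3, 4} : Finset (Fin 6)) ⊆ {1, 2, 4, 5} ∧ ¬ ({0, 1, 3, 4} : Finset (Fin 6)) ⊆ {3, 4} ∧
    ¬ ({0, 1, 3, 4} : Finset (Fin 6)) ⊆ {0, 1, 2} ∧ ¬ ({1, 2, 4, 5} : Finset (Fin 6)) ⊆ {3, 4} ∧
    ¬ ({1, 2, 4, 5} : Finset (Fin 6)) ⊆ {0, 1, 2} ∧ ¬ ({3, 4} : Finset (Fin 6)) ⊆ {0, 1, 2} := by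
  decide

/-- Over `ZMod 7` at `t = 4`, the vector `c = (2, 3, 1, 1)` on `(A₁, A₂, A₃, A₄)` kills every column `E` of the ordered
half: `∑_C c_C ([E ⊆ C] + 4 [E ∩ C = ∅]) = 0`. -/
theorem ordHalf_four_sets_sum_zero :
    ∀ E ∈ ({∅, {0, 3}, {0, 1}, {3, 4}, {1, 2, 5}, {4, 5}} : Finset (Finset (Fin 6))),
      ∑ C ∈ ({{0, 1, 3, 4}, {1, 2, 4, 5}, {3, 4}, {0, 1, 2}} : Finset (Finset (Fin 6))),
        (if C = {0, 1, 3, 4} then (2 : ZMod 7) else if C = {1, 2, 4, 5} then 3 else 1) *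
          ((if E ⊆ C then (1 : ZMod 7) else 0) + 4 * (if Disjoint E C then (1 : ZMod 7) else 0)) = 0 := by
  decide

/-- **CONJECTURE ORD is false over finite fields, already for four sets.**  For `𝒜 = {A₁, A₂, A₃, A₄}` as above and the
ordered half `T = {∅, {0,3}, {0,1}, {3,4}, {1,2,5}, {4,5}}` of its difference family, the pencil rows
`C ↦ (E ↦ [E ⊆ C] + 4 [E ∩ C = ∅])` (`E ∈ T`) are linearly DEPENDENT over `ZMod 7`, although `4 · 4 ≠ 1`. -/
theorem ordHalf_four_sets_not_linearIndependent :
    (4 : ZMod 7) * 4 ≠ 1 ∧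
    ¬ LinearIndependent (ZMod 7)
      (fun C : ({{0, 1, 3, 4}, {1, 2, 4, 5}, {3, 4}, {0, 1, 2}} : Finset (Finset (Fin 6))) =>
        fun E : ({∅, {0, 3}, {0, 1}, {3, 4}, {1, 2, 5}, {4, 5}} : Finset (Finset (Fin 6))) =>
          (if (E : Finset (Fin 6)) ⊆ (C : Finset (Fin 6)) then (1 : ZMod 7) else 0) +
            4 * (if Disjoint (E : Finset (Fin 6)) (C : Finset (Fin 6)) then (1 : ZMod 7) else 0)) := by
  refine ⟨by decide, ?_⟩
  rw [Fintype.not_linearIndependent_iff]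
  refine ⟨fun C => if (C : Finset (Fin 6)) = {0, 1, 3, 4} then (2 : ZMod 7)
      else if (C : Finset (Fin 6)) = {1, 2, 4, 5} then 3 else 1, ?_, ⟨⟨{3, 4}, by simp⟩, by decide⟩⟩
  funext E
  obtain ⟨E, hE⟩ := E
  simp only [Finset.sum_apply, Pi.smul_apply, smul_eq_mul, Pi.zero_apply]
  have e : (∑ C : ({{0, 1, 3, 4}, {1, 2, 4, 5}, {3, 4}, {0, 1, 2}} : Finset (Finset (Fin 6))),
      (if (C : Finset (Fin 6)) = {0, 1, 3, 4} then (2 : ZMod 7) else if (C : Finset (Fin 6)) = {1, 2, 4, 5} then 3 else 1) *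
        ((if E ⊆ (C : Finset (Fin 6)) then (1 : ZMod 7) else 0) +
          4 * (if Disjoint E (C : Finset (Fin 6)) then (1 : ZMod 7) else 0))) =
      ∑ C ∈ ({{0, 1, 3, 4}, {1, 2, 4, 5}, {3, 4}, {0, 1, 2}} : Finset (Finset (Fin 6))),
        (if C = {0, 1, 3, 4} then (2 : ZMod 7) else if C = {1, 2, 4, 5} then 3 else 1) *
          ((if E ⊆ C then (1 : ZMod 7) else 0) + 4 * (if Disjoint E C then (1 : ZMod 7) else 0)) :=
    Finset.sum_coe_sort _ (fun C => (if C = {0, 1, 3, 4} then (2 : ZMod 7) else if C = {1, 2, 4, 5} then 3 else 1) *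
      ((if E ⊆ C then (1 : ZMod 7) else 0) + 4 * (if Disjoint E C then (1 : ZMod 7) else 0)))
  rw [e]
  exact ordHalf_four_sets_sum_zero E hE

end OrderedDifferences

end Summit.CriticalPhenomena.PercolationContinuityZ3.Theorems
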